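import Summits.HubbardSuperconductivity.HubbardLadder.DoubleCommutatorBlocks
import HarnessLib

/-!
# Rung R1/R2 — classical-marginal ("diagonal N-representability") cut BLOCKS, kind `zcut` — part 1/2:
# diagonal letters, words, polynomials, the block `zcutForm` and its any-state validity

HONEST FRAMING (page 1): ladder R1–R4 with certified numbers; no claim on H/H₀.

This is the generic half of pseudo g15's `ClassicalMarginalRows.lean` (LEAN FILING REQUEST #90), split off
verbatim by the filing seat (lit g5) because the gate caps `Summits/…` files at 400 lines (`lint.size`);
no statement was changed.  The energy rows (`groundEnergy_ge_of_certificate_kkt_dcomm_zcut`,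
`groundEnergy_ge_of_certificate_zcut`, `heisenbergTorus_groundEnergy_ge_of_certificate_zcut`) and the concrete
spin / fermion letters live in part 2/2, `ClassicalMarginalRows.lean`, which imports this file and carries the
full mathematical description, scope statement and sources (Deza–Laurent 1997 ch. 5; Ayers–Davidson 2006;
Kull et al. 2024 §5.3; Tasaki 2020).  Contents here: `zcutLetter`, `zcutWord`, `zcutEval`, `zcutWord_eq_diagonal`,
`zcutPoly`, `zcutPolyEval`, `zcutPoly_eq_diagonal`, `posSemidef_sub_zcutPoly` (the reader test `h⋆ ≤ u` ⇒
`u·1 − W ⪰ 0`), `posSemidef_zcutPoly_sub`, `zcutEval_nonneg`, `posSemidef_zcutWord_of_nonneg` (F18a), `zcutForm`,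
`posSemidef_smul_sub_zcutPoly`, `posSemidef_zcutForm`, and the any-state validity / residual-absorption lemmas
`map_nonneg_of_posSemidef`, `re_map_zcutPoly_le`, `re_map_zcutForm_nonneg`, `re_map_zcutForm_add_ge`,
`re_groundStateFunctional_zcutForm_add_ge`, `re_dotProduct_zcutForm_add_mulVec_ge`, `posSemidef_zcutForm_add_add_smul`.
No named facts; everything is proved.
-/

namespace Summit.HubbardSuperconductivity.HubbardLadder

open Matrix Finset Literature.Probability.LatticeModels
  Literature.MathematicalPhysics.QuantumLattice
  Literature.MathematicalPhysics.QuantumManyBody.StateRelaxation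
open scoped Matrix.Norms.L2Operator ComplexOrder MatrixOrder

noncomputable section

/-! ## §1 Diagonal letters, words, polynomials; the block and its positivity -/

section Diagonal

variable {n : Type*} [Fintype n] [DecidableEq n]
variable {α : Type*}

/-- The diagonal LETTER `Z_a = diag (s ↦ z a s)` with real eigenvalue table `z a : n → ℝ`.
Deza–Laurent (1997) ch. 5. [cite: DezaLaurent1997, ch. 5] -/
def zcutLetter (z : α → n → ℝ) (a : α) : Matrix n n ℂ :=
  diagonal fun s => ((z a s : ℝ) : ℂ)

/-- The WORD `Π_{a ∈ w} Z_a` (ordered matrix product along the list `w`).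
Deza–Laurent (1997) ch. 5. [cite: DezaLaurent1997, ch. 5] -/
def zcutWord (z : α → n → ℝ) (w : List α) : Matrix n n ℂ :=
  (w.map (zcutLetter z)).prod

/-- The CLASSICAL value of the word `w` at the basis state `s`: `Π_{a ∈ w} z a s`.
Deza–Laurent (1997) ch. 5. [cite: DezaLaurent1997, ch. 5] -/
def zcutEval (z : α → n → ℝ) (w : List α) (s : n) : ℝ :=
  (w.map fun a => z a s).prod

/-- A word of diagonal letters is the diagonal matrix of its classical values.
Deza–Laurent (1997) ch. 5. [cite: DezaLaurent1997, ch. 5] -/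
theorem zcutWord_eq_diagonal (z : α → n → ℝ) (w : List α) :
    zcutWord z w = diagonal fun s => ((zcutEval z w s : ℝ) : ℂ) := by
  induction w with
  | nil =>
    simp only [zcutWord, zcutEval, List.map_nil, List.prod_nil, Complex.ofReal_one, diagonal_one]
  | cons a w ih =>
    simp only [zcutWord, zcutEval, List.map_cons, List.prod_cons] at ih ⊢
    rw [ih, zcutLetter, diagonal_mul_diagonal]
    congr 1
    funext s
    rw [Complex.ofReal_mul]

variable {κ : Type*} [Fintype κ]

/-- The diagonal POLYNOMIAL `W = Σ_k a_k • Π_{a ∈ w_k} Z_a` with real coefficients (the operator of a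
`zcut` row). Deza–Laurent (1997) ch. 5. [cite: DezaLaurent1997, ch. 5] -/
def zcutPoly (z : α → n → ℝ) (a : κ → ℝ) (w : κ → List α) : Matrix n n ℂ :=
  ∑ k, ((a k : ℝ) : ℂ) • zcutWord z (w k)

/-- The classical polynomial `s ↦ Σ_k a_k Π_{a ∈ w_k} z a s` whose finite maximum `h⋆` the reader
recomputes. Deza–Laurent (1997) ch. 5. [cite: DezaLaurent1997, ch. 5] -/
def zcutPolyEval (z : α → n → ℝ) (a : κ → ℝ) (w : κ → List α) (s : n) : ℝ :=
  ∑ k, a k * zcutEval z (w k) s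

/-- `W` is the diagonal matrix of the classical polynomial.
Deza–Laurent (1997) ch. 5. [cite: DezaLaurent1997, ch. 5] -/
theorem zcutPoly_eq_diagonal (z : α → n → ℝ) (a : κ → ℝ) (w : κ → List α) :
    zcutPoly z a w = diagonal fun s => ((zcutPolyEval z a w s : ℝ) : ℂ) := by
  ext i j
  simp only [zcutPoly, zcutPolyEval, Matrix.sum_apply, Matrix.smul_apply, zcutWord_eq_diagonal,
    diagonal_apply, smul_eq_mul]
  by_cases h : i = j
  · subst h
    simp only [if_true]
    push_cast
    rfl
  · simp [h]

/-- **Soundness of a `zcut` row as an operator inequality**: if the classical polynomial is bounded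
by `u` at EVERY basis state (`h⋆ ≤ u`, the reader's acceptance test), then `u·1 − W ⪰ 0`.
Ayers–Davidson (2006) §2; Deza–Laurent (1997) ch. 5. [cite: DezaLaurent1997, ch. 5] -/
theorem posSemidef_sub_zcutPoly (z : α → n → ℝ) (a : κ → ℝ) (w : κ → List α) {u : ℝ}
    (hu : ∀ s, zcutPolyEval z a w s ≤ u) :
    (((u : ℝ) : ℂ) • (1 : Matrix n n ℂ) - zcutPoly z a w).PosSemidef := by
  rw [zcutPoly_eq_diagonal, smul_one_eq_diagonal, diagonal_sub]
  refine posSemidef_diagonal_iff.mpr fun s => ?_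
  rw [← Complex.ofReal_sub]
  exact Complex.zero_le_real.mpr (sub_nonneg.mpr (hu s))

/-- Lower-bound twin: if `l ≤` the classical polynomial everywhere then `W − l·1 ⪰ 0`.
Deza–Laurent (1997) ch. 5. [cite: DezaLaurent1997, ch. 5] -/
theorem posSemidef_zcutPoly_sub (z : α → n → ℝ) (a : κ → ℝ) (w : κ → List α) {l : ℝ}
    (hl : ∀ s, l ≤ zcutPolyEval z a w s) :
    (zcutPoly z a w - ((l : ℝ) : ℂ) • (1 : Matrix n n ℂ)).PosSemidef := by
  rw [zcutPoly_eq_diagonal, smul_one_eq_diagonal, diagonal_sub]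
  refine posSemidef_diagonal_iff.mpr fun s => ?_
  rw [← Complex.ofReal_sub]
  exact Complex.zero_le_real.mpr (sub_nonneg.mpr (hl s))

omit [Fintype n] [DecidableEq n] in
/-- Classical values of words over letters with NONNEGATIVE tables are nonnegative (F18a).
Ayers–Davidson (2006) §2. [cite: DezaLaurent1997, ch. 5] -/
theorem zcutEval_nonneg {z : α → n → ℝ} (hz : ∀ a s, 0 ≤ z a s) (w : List α) (s : n) :
    0 ≤ zcutEval z w s := by
  induction w with
  | nil => simp [zcutEval]
  | cons a w ih =>
    simp only [zcutEval, List.map_cons, List.prod_cons] at ih ⊢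
    exact mul_nonneg (hz a s) ih

/-- **F18a (monomial / inclusion–exclusion positivity)**: a word over letters with nonnegative
tables is itself `⪰ 0`, so `0 ≤ ω(Π Z_a)` in every state.
Ayers–Davidson (2006) §2. [cite: DezaLaurent1997, ch. 5] -/
theorem posSemidef_zcutWord_of_nonneg {z : α → n → ℝ} (hz : ∀ a s, 0 ≤ z a s) (w : List α) :
    (zcutWord z w).PosSemidef := by
  rw [zcutWord_eq_diagonal]
  exact posSemidef_diagonal_iff.mpr fun s => Complex.zero_le_real.mpr (zcutEval_nonneg hz w s)

variable {ι : Type*} [Fintype ι]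

/-- The `zcut` BLOCK of a certificate: `Σ_j κ_j • (u_j·1 − W_j)`, one classical-marginal cut per
`j` with multiplier `κ_j` (the dual variable of the row `ω(W_j) ≤ u_j`).  Rows with fewer terms are
padded with zero coefficients. Kull et al. (2024) §5.3; Deza–Laurent (1997) ch. 5.
[cite: KullEtAl2024, §5.3] [cite: DezaLaurent1997, ch. 5] -/
def zcutForm (z : α → n → ℝ) (κ' u : ι → ℝ) (a : ι → κ → ℝ) (w : ι → κ → List α) :
    Matrix n n ℂ :=
  ∑ j, ((κ' j : ℝ) : ℂ) • ((((u j : ℝ) : ℂ)) • (1 : Matrix n n ℂ) - zcutPoly z (a j) (w j))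

/-- One weighted cut `κ • (u·1 − W) ⪰ 0` for `κ ≥ 0`, `h⋆ ≤ u`.
Deza–Laurent (1997) ch. 5. [cite: DezaLaurent1997, ch. 5] -/
theorem posSemidef_smul_sub_zcutPoly (z : α → n → ℝ) (a : κ → ℝ) (w : κ → List α) {c u : ℝ}
    (hc : 0 ≤ c) (hu : ∀ s, zcutPolyEval z a w s ≤ u) :
    (((c : ℝ) : ℂ) • ((((u : ℝ) : ℂ)) • (1 : Matrix n n ℂ) - zcutPoly z a w)).PosSemidef := by
  rw [zcutPoly_eq_diagonal, smul_one_eq_diagonal, diagonal_sub, ← diagonal_smul]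
  refine posSemidef_diagonal_iff.mpr fun s => ?_
  simp only [Pi.smul_apply, smul_eq_mul]
  rw [← Complex.ofReal_sub, ← Complex.ofReal_mul]
  exact Complex.zero_le_real.mpr (mul_nonneg hc (sub_nonneg.mpr (hu s)))

/-- **The `zcut` block is positive semidefinite** for multipliers `κ_j ≥ 0` and bounds `u_j` passing
the reader's test `∀ s, Σ_k a_jk Π z ≤ u_j`. Kull et al. (2024) §5.3; Deza–Laurent (1997) ch. 5.
[cite: KullEtAl2024, §5.3] [cite: DezaLaurent1997, ch. 5] -/
theorem posSemidef_zcutForm (z : α → n → ℝ) {κ' u : ι → ℝ} (a : ι → κ → ℝ) (w : ι → κ → List α)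
    (hκ : ∀ j, 0 ≤ κ' j) (hu : ∀ j s, zcutPolyEval z (a j) (w j) s ≤ u j) :
    (zcutForm z κ' u a w).PosSemidef :=
  posSemidef_sum Finset.univ fun j _ => posSemidef_smul_sub_zcutPoly z (a j) (w j) (hκ j) (hu j)

/-! ### Any-state validity (positive functionals, vector states, operator residuals) -/

/-- A positive linear functional is nonnegative on positive semidefinite matrices
(`D = Bᴴ B`). Bratteli–Robinson II §2.3.1. [folklore] -/
theorem map_nonneg_of_posSemidef (ω : Matrix n n ℂ →ₗ[ℂ] ℂ) (hpos : ∀ x, 0 ≤ ω (star x * x))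
    {D : Matrix n n ℂ} (hD : D.PosSemidef) : 0 ≤ ω D := by
  obtain ⟨B, hB⟩ := CStarAlgebra.nonneg_iff_eq_star_mul_self.mp hD.nonneg
  rw [hB]
  exact hpos B

/-- **`zcut` rows hold in EVERY state**: `Re ω(W) ≤ u` for a positive normalised functional `ω`
whenever `h⋆ ≤ u`. Ayers–Davidson (2006) §2; Deza–Laurent (1997) ch. 5. [cite: DezaLaurent1997, ch. 5] -/
theorem re_map_zcutPoly_le (ω : Matrix n n ℂ →ₗ[ℂ] ℂ) (hpos : ∀ x, 0 ≤ ω (star x * x))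
    (hone : ω 1 = 1) (z : α → n → ℝ) (a : κ → ℝ) (w : κ → List α) {u : ℝ}
    (hu : ∀ s, zcutPolyEval z a w s ≤ u) : (ω (zcutPoly z a w)).re ≤ u := by
  have h := map_nonneg_of_posSemidef ω hpos (posSemidef_sub_zcutPoly z a w hu)
  rw [map_sub, map_smul, hone, smul_eq_mul, mul_one] at h
  have h' := (Complex.nonneg_iff.mp h).1
  rw [Complex.sub_re, Complex.ofReal_re] at h'
  linarith

/-- The block has nonnegative expectation in every positive functional.
Kull et al. (2024) §5.3. [cite: KullEtAl2024, §5.3] -/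
theorem re_map_zcutForm_nonneg (ω : Matrix n n ℂ →ₗ[ℂ] ℂ) (hpos : ∀ x, 0 ≤ ω (star x * x))
    (z : α → n → ℝ) {κ' u : ι → ℝ} (a : ι → κ → ℝ) (w : ι → κ → List α)
    (hκ : ∀ j, 0 ≤ κ' j) (hu : ∀ j s, zcutPolyEval z (a j) (w j) s ≤ u j) :
    0 ≤ (ω (zcutForm z κ' u a w)).re :=
  (Complex.nonneg_iff.mp (map_nonneg_of_posSemidef ω hpos (posSemidef_zcutForm z a w hκ hu))).1

/-- **Residual absorption, functional form**: a residual bound `−ε ≤ Re ω(r)` survives adding the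
block, `−ε ≤ Re ω(zcutForm + r)` — so the block rides in the residual slot of every row whose state
is a positive functional. Kull et al. (2024) §5.3. [cite: KullEtAl2024, §5.3] -/
theorem re_map_zcutForm_add_ge (ω : Matrix n n ℂ →ₗ[ℂ] ℂ) (hpos : ∀ x, 0 ≤ ω (star x * x))
    (z : α → n → ℝ) {κ' u : ι → ℝ} (a : ι → κ → ℝ) (w : ι → κ → List α)
    (hκ : ∀ j, 0 ≤ κ' j) (hu : ∀ j s, zcutPolyEval z (a j) (w j) s ≤ u j)
    {r : Matrix n n ℂ} {ε : ℝ} (hr : -ε ≤ (ω r).re) :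
    -ε ≤ (ω (zcutForm z κ' u a w + r)).re := by
  rw [map_add, Complex.add_re]
  have h0 := re_map_zcutForm_nonneg ω hpos z a w hκ hu
  linarith

/-- Residual absorption for the TRACIAL GROUND STATE `ω₀` of any matrix `A` (the residual slot of
`groundEnergy_ge_of_certificate_kkt_dcomm`, `EigenWindowObservable` §4, …).
Kull et al. (2024) §5.3. [cite: KullEtAl2024, §5.3] -/
theorem re_groundStateFunctional_zcutForm_add_ge (A : Matrix n n ℂ)
    (z : α → n → ℝ) {κ' u : ι → ℝ} (a : ι → κ → ℝ) (w : ι → κ → List α)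
    (hκ : ∀ j, 0 ≤ κ' j) (hu : ∀ j s, zcutPolyEval z (a j) (w j) s ≤ u j)
    {r : Matrix n n ℂ} {ε : ℝ} (hr : -ε ≤ (A.groundStateFunctional r).re) :
    -ε ≤ (A.groundStateFunctional (zcutForm z κ' u a w + r)).re :=
  re_map_zcutForm_add_ge _ (fun x => by
    rw [Matrix.star_eq_conjTranspose]; exact groundStateFunctional_nonneg A x) z a w hκ hu hr

/-- **Residual absorption, vector form** (the residual slot of the sector / window rows
`KKTWindowRows`, `EigenWindowObservable` §2–3): `−ε ≤ Re ⟨ψ, r ψ⟩ → −ε ≤ Re ⟨ψ, (zcutForm + r) ψ⟩`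
for EVERY vector `ψ`. Kull et al. (2024) §5.3. [cite: KullEtAl2024, §5.3] -/
theorem re_dotProduct_zcutForm_add_mulVec_ge (z : α → n → ℝ) {κ' u : ι → ℝ} (a : ι → κ → ℝ)
    (w : ι → κ → List α) (hκ : ∀ j, 0 ≤ κ' j) (hu : ∀ j s, zcutPolyEval z (a j) (w j) s ≤ u j)
    (ψ : n → ℂ) {r : Matrix n n ℂ} {ε : ℝ} (hr : -ε ≤ (star ψ ⬝ᵥ r *ᵥ ψ).re) :
    -ε ≤ (star ψ ⬝ᵥ (zcutForm z κ' u a w + r) *ᵥ ψ).re := by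
  rw [add_mulVec, dotProduct_add, Complex.add_re]
  have h0 := (Complex.nonneg_iff.mp
    ((posSemidef_zcutForm z a w hκ hu).dotProduct_mulVec_nonneg ψ)).1
  linarith

/-- **Residual absorption, operator form** (the residual slot `R + δ·1 ⪰ 0` of `LiebGramRows`,
`LiebGramRowsRect`): `zcutForm + R + δ·1 ⪰ 0`. Kull et al. (2024) §5.3. [cite: KullEtAl2024, §5.3] -/
theorem posSemidef_zcutForm_add_add_smul (z : α → n → ℝ) {κ' u : ι → ℝ} (a : ι → κ → ℝ)
    (w : ι → κ → List α) (hκ : ∀ j, 0 ≤ κ' j) (hu : ∀ j s, zcutPolyEval z (a j) (w j) s ≤ u j)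
    {R : Matrix n n ℂ} {δ : ℝ} (hR : (R + (δ : ℂ) • (1 : Matrix n n ℂ)).PosSemidef) :
    (zcutForm z κ' u a w + R + (δ : ℂ) • (1 : Matrix n n ℂ)).PosSemidef := by
  rw [add_assoc]
  exact (posSemidef_zcutForm z a w hκ hu).add hR

end Diagonal

end

end Summit.HubbardSuperconductivity.HubbardLadder
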